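import Summits.Ventures.LatticeQCDFlow.Scaling.CalibratedWindow

/-!
# LatticeQCDFlow / Scaling — exact small-ball asymptotics of `U(1)` and the CONSTANT-FREE calibrated window laws for compact `U(1)` lattice gauge theory: `#E·log Lip(T) ≥ (β - β₀)·(S(U) - ⟨S⟩_{β₀})`

HONEST FRAMING: exact (Metropolis-corrected) sampling algorithms for lattice gauge theory; figures of merit are
autocorrelation/cost numbers at stated couplings and volumes; no continuum-physics claim.

Venture `LatticeQCDFlow` (cell pub-lqcd), topic `Scaling`, FANOUT row 29 (theory-2) — OUR WORK (THEORY-2.md §3.3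
v2.9, rows (C2a-W⁺) / (C2a-H⁺), `U(1)` column).  `Scaling/CalibratedWindow.lean` proves the calibrated window laws
with the constant `log(A/a)` of any two-sided small-ball estimate `a·r^κ ≤ Haar(B̄(g,r)) ≤ A·r^κ` (`0 < r ≤ r₁`), and
the constant-free laws under the hypothesis item `SmallBallAsymptotics G κ` (`A/a → 1`).  This file DISCHARGES that
hypothesis for `G = U(1) = Circle` with the chordal metric of `ℂ` (`κ = 1`):

* `U1.abs_arg_le_two_arcsin` — chord controls angle SHARPLY: `|arg z| ≤ 2·arcsin(‖z - 1‖/2)` (`‖e^{iθ} - 1‖ =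
  2|sin(θ/2)|`); `U1.chordBall_subset_arc_arcsin`; `U1.haar_closedBall_le_arcsin` — `Haar(B̄(g,r)) ≤
  2·arcsin(r/2)/π` for `0 ≤ r < 2` (with the tree's `Haar(B̄(g,r)) ≥ r/π`, `r ≤ 1`, this is the exact value
  `2·arcsin(r/2)/π` up to the elementary `arcsin s ≥ s`);
* `U1.two_arcsin_half_le` — `2·arcsin(r/2) ≤ (1 + ε)·r` for `0 < r ≤ ε/2`, `0 < ε ≤ 1` (from Mathlib's
  `sin x > x - x³/6`);
* `U1.smallBallAsymptotics : SmallBallAsymptotics Circle 1` **(PROVED)** — for every `ε > 0`: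
  `r/π ≤ Haar(B̄(g,r)) ≤ (1 + ε)·r/π` for `0 < r ≤ min(ε,1)/2`;
* `U1.calibratedCoolingWindow_zero d : CalibratedCoolingWindow d 1 U(1) u1Rep 1 0` and
  `U1.calibratedHeatingWindow_zero d : CalibratedHeatingWindow d 1 U(1) u1Rep 1 0` **(C2a-W⁺/H⁺, constant-free,
  no hypothesis left)**: for every `d`, `L`, `0 ≤ β₀ ≤ β`, every exact `K`-Lipschitz transport `T_* μ_{β₀} = μ_β`
  of compact-`U(1)` Wilson laws and every configuration `U`: `(β - β₀)·(S(U) - ⟨S⟩_{β₀}) ≤ #E·log K`; reading at a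
  maximal-action configuration in `d = 2` (`#E = 2#P`, `S_max = 2#P`, `L` even):
  `log Lip(T) ≥ (β - β₀)·(1 - ⟨1 - cos θ_p⟩_{β₀}/2)`, e.g. `≥ 0.5·(β - β₀)` from `β₀ = 0` and
  `≥ (β - β₀)·(1 + I₁(β₀)/I₀(β₀))/2` in general (one-plaquette value of `⟨1 - cos θ_p⟩_{β₀} = 1 - I₁/I₀(β₀)` as the
  mean-field reading; the law itself uses the true finite-volume mean) — and the co-Lipschitz mirror for heating.

Elementary given the tree (Mathlib: `Real.arcsin_sin`, `Real.arcsin_le_iff_le_sin'`, `Real.sin_gt_sub_cube`,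
`Real.sin_sq_eq_half_sub`); nothing here is cited as a fact.
-/

noncomputable section

namespace Summit.Ventures.LatticeQCDFlow.Theory2.Lattice

open MeasureTheory Metric Set Literature.MathematicalPhysics.QuantumFieldTheory
open Literature.MathematicalPhysics.QuantumLattice (u1Rep continuous_u1Rep)

namespace U1

/-- **Chord controls angle, sharp form**: `|arg z| ≤ 2·arcsin(‖z - 1‖/2)` on the unit circle
(`‖e^{iθ} - 1‖² = 2 - 2cos θ = 4sin²(θ/2)` and `arcsin ∘ sin = id` on `[-π/2, π/2]`). [folklore] -/
theorem abs_arg_le_two_arcsin (z : Circle) :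
    |Complex.arg (z : ℂ)| ≤ 2 * Real.arcsin (‖(z : ℂ) - 1‖ / 2) := by
  set θ := Complex.arg (z : ℂ) with hθ
  have hθπ : θ ∈ Set.Ioc (-Real.pi) Real.pi := Complex.arg_mem_Ioc _
  have hz : Circle.exp θ = z := Circle.exp_arg z
  have h1 := SUNHaar.norm_coe_exp_sub_one_sq θ
  rw [hz] at h1
  have h2 : Real.sin (θ / 2) ^ 2 = 1 / 2 - Real.cos θ / 2 := by
    have := Real.sin_sq_eq_half_sub (θ / 2)
    rwa [show 2 * (θ / 2) = θ by ring] at this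
  have h3 : (2 * Real.sin (θ / 2)) ^ 2 = ‖(z : ℂ) - 1‖ ^ 2 := by rw [mul_pow, h2, h1]; ring
  have h4 : |2 * Real.sin (θ / 2)| = ‖(z : ℂ) - 1‖ := by
    have := (sq_eq_sq_iff_abs_eq_abs _ _).1 h3
    rwa [abs_of_nonneg (norm_nonneg _)] at this
  have hs : |Real.sin (θ / 2)| = ‖(z : ℂ) - 1‖ / 2 := by
    rw [abs_mul, abs_two] at h4
    linarith
  have hlo : -(Real.pi / 2) ≤ θ / 2 := by linarith [hθπ.1]
  have hhi : θ / 2 ≤ Real.pi / 2 := by linarith [hθπ.2]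
  have key : Real.arcsin (Real.sin (θ / 2)) = θ / 2 := Real.arcsin_sin hlo hhi
  have up : θ / 2 ≤ Real.arcsin (‖(z : ℂ) - 1‖ / 2) := by
    rw [← key, ← hs]
    exact Real.arcsin_le_arcsin (le_abs_self _)
  have dn : -Real.arcsin (‖(z : ℂ) - 1‖ / 2) ≤ θ / 2 := by
    rw [← key, ← hs, ← Real.arcsin_neg]
    exact Real.arcsin_le_arcsin (neg_abs_le _)
  rw [abs_le]
  constructor <;> linarith

/-- The chordal ball `{‖z - 1‖ ≤ t}` lies in the arc `exp(i[-2arcsin(t/2), 2arcsin(t/2)])` (sharp for `t ≤ 2`;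
the tree's `SUNHaar.chordBall_subset_arc` has the Jordan-inequality arc `πt/2`). [folklore] -/
theorem chordBall_subset_arc_arcsin (t : ℝ) :
    {z : Circle | ‖(z : ℂ) - 1‖ ≤ t} ⊆ arc (2 * Real.arcsin (t / 2)) := by
  intro z hz
  rw [mem_setOf_eq] at hz
  refine ⟨Complex.arg (z : ℂ), ?_, Circle.exp_arg z⟩
  have h := abs_arg_le_two_arcsin z
  have hmono : Real.arcsin (‖(z : ℂ) - 1‖ / 2) ≤ Real.arcsin (t / 2) :=
    Real.arcsin_le_arcsin (by linarith)
  rw [abs_le] at h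
  rw [mem_Icc]
  constructor <;> linarith [h.1, h.2]

/-- **Sharp upper ball volume on `U(1)`**: `Haar(B̄(g,r)) ≤ 2·arcsin(r/2)/π` for `0 ≤ r < 2` (chordal metric;
this is in fact the exact value). [folklore] -/
theorem haar_closedBall_le_arcsin (g : Circle) {r : ℝ} (hr0 : 0 ≤ r) (hr2 : r < 2) :
    (haarProbability Circle (closedBall g r)).toReal ≤ 2 * Real.arcsin (r / 2) / Real.pi := by
  rw [haar_closedBall_eq, closedBall_one_eq]
  have h0 : 0 ≤ 2 * Real.arcsin (r / 2) := by
    have := Real.arcsin_nonneg.2 (show 0 ≤ r / 2 by positivity)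
    linarith
  have hπ' : 2 * Real.arcsin (r / 2) < Real.pi := by
    have := Real.arcsin_lt_pi_div_two.2 (show r / 2 < 1 by linarith)
    linarith
  calc (haarProbability Circle {z : Circle | ‖(z : ℂ) - 1‖ ≤ r}).toReal
      ≤ (haarProbability Circle (arc (2 * Real.arcsin (r / 2)))).toReal :=
        ENNReal.toReal_mono (measure_ne_top _ _) (measure_mono (chordBall_subset_arc_arcsin r))
    _ ≤ 2 * Real.arcsin (r / 2) / Real.pi := SUNHaar.haar_arc_le h0 hπ'

/-- `2·arcsin(r/2) ≤ (1 + ε)·r` for `0 < r ≤ ε/2`, `0 < ε ≤ 1` (from `sin x > x - x³/6`). [folklore] -/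
theorem two_arcsin_half_le {ε r : ℝ} (hε : 0 < ε) (hε1 : ε ≤ 1) (hr : 0 < r) (hr1 : r ≤ ε / 2) :
    2 * Real.arcsin (r / 2) ≤ (1 + ε) * r := by
  set y := (1 + ε) * (r / 2) with hy
  have hy0 : 0 < y := by positivity
  have hyr : y ≤ r := by rw [hy]; nlinarith
  have hy1 : y < Real.pi / 2 := by linarith [Real.pi_gt_three]
  have hsin : y - y ^ 3 / 6 < Real.sin y := Real.sin_gt_sub_cube hy0
  have hr2 : r ^ 2 ≤ 2 * ε := by nlinarith
  have hy3 : y ^ 3 ≤ r ^ 3 := by gcongr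
  have hr3 : r ^ 3 ≤ 2 * ε * r := by nlinarith
  have h2 : r / 2 ≤ Real.sin y := by nlinarith
  have h3 : Real.arcsin (r / 2) ≤ y := (Real.arcsin_le_iff_le_sin' ⟨by linarith, hy1⟩).2 h2
  linarith

/-- **Exact small-ball asymptotics of `U(1)`** (chordal metric, `κ = 1`, **PROVED**): for every `ε > 0`,
`r/π ≤ Haar(B̄(g,r)) ≤ (1 + ε)·r/π` for `0 < r ≤ min(ε,1)/2` — the hypothesis item `SmallBallAsymptotics Circle 1`
of `Scaling/CalibratedWindowSteps.lean` holds. [folklore] -/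
theorem smallBallAsymptotics : SmallBallAsymptotics Circle 1 := by
  intro ε hε
  set ε' := min ε 1 with hε'
  have hε'0 : 0 < ε' := lt_min hε one_pos
  have hε'1 : ε' ≤ 1 := min_le_right _ _
  have hε'ε : ε' ≤ ε := min_le_left _ _
  have hπ : 0 < Real.pi := Real.pi_pos
  refine ⟨ε' / 2, 1 / Real.pi, (1 + ε') / Real.pi, by positivity, by positivity, ?_,
    fun g r hr hr1 => ⟨haar_closedBall_ge g hr (by linarith), ?_⟩⟩
  · rw [div_le_iff₀ hπ]
    have : (1 + ε) * (1 / Real.pi) * Real.pi = 1 + ε := by field_simp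
    rw [this]
    linarith
  · calc (haarProbability Circle (closedBall g r)).toReal ≤ 2 * Real.arcsin (r / 2) / Real.pi :=
          haar_closedBall_le_arcsin g hr.le (by linarith)
      _ ≤ (1 + ε') * r / Real.pi :=
          div_le_div_of_nonneg_right (two_arcsin_half_le hε'0 hε'1 hr hr1) hπ.le
      _ = (1 + ε') / Real.pi * r ^ 1 := by ring

end U1

/-- **(C2a-W⁺) for compact `U(1)`, constant-free, every `d`** (OURS, no hypothesis left): for every `L`, every
`0 ≤ β₀ ≤ β`, every exact `K`-Lipschitz transport `T_* μ_{β₀} = μ_β` of the `U(1)` Wilson laws (chordal sup metric)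
and every configuration `U`: `(β - β₀)·(S(U) - ⟨S⟩_{β₀}) ≤ #E·log K`.  In `d = 2` at a maximal-action `U`
(`L` even): `log Lip(T) ≥ (β - β₀)·(1 - ⟨1 - cos θ_p⟩_{β₀}/2) ≥ (β - β₀)/2`. [folklore] -/
theorem U1.calibratedCoolingWindow_zero (d : ℕ) : CalibratedCoolingWindow d 1 Circle u1Rep 1 0 :=
  calibratedCoolingWindow_of_smallBallAsymptotics u1Rep d continuous_u1Rep U1.re_trace_u1Rep_le
    U1.neg_one_le_re_trace U1.smallBallAsymptotics

/-- **(C2a-H⁺) for compact `U(1)`, constant-free, every `d`** (OURS, no hypothesis left): for every `L`, every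
`0 ≤ β ≤ β₀`, every exact `K'`-co-Lipschitz transport `T_* μ_{β₀} = μ_β` and every configuration `U`:
`(β₀ - β)·(S(U) - ⟨S⟩_β) ≤ #E·log K'`. [folklore] -/
theorem U1.calibratedHeatingWindow_zero (d : ℕ) : CalibratedHeatingWindow d 1 Circle u1Rep 1 0 :=
  calibratedHeatingWindow_of_smallBallAsymptotics u1Rep d continuous_u1Rep U1.re_trace_u1Rep_le
    U1.smallBallAsymptotics

end Summit.Ventures.LatticeQCDFlow.Theory2.Lattice
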